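import Summits.CriticalPhenomena.PercolationContinuityZ3.Theorems.Transplant.FKConnectivityAllQAntipodalMajTheta
import Summits.CriticalPhenomena.PercolationContinuityZ3.Theorems.Transplant.FKConnectivityAllQAntipodalMinorWeightNested
import HarnessLib

/-!
# Connectivity correlation inequalities for `φ_{w,q}`, every `q > 0` — file 51a: lemmas for the MIX CRITERION of the `q`-free `maj₃`
# inequality — the pointwise pattern identity, increments of blind test functions, and Theorem U at a pivot READ BY A NESTED PAIR

Support file (`--supports stmt-CriticalPhenomena-4575`), FK sub-lane `prim-bschramm-fk-2` (gen 25); builds on p205010 (kernel theorem,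
internal audit signed; external expert review pending).  No definitions, no named facts, no sorries; standard axioms.

The flow criterion of memo FROM-fk-2-g24-BLACKBOX §4 (Theorem A) writes the signed `maj₃` pattern sum as single-special FLIPS and
aggregates the flips of one special by the state of the rest of the host.  This file supplies the three generic ingredients used by
`…MajMixMixed.lean` / `…MajMixCriterion.lean`:
* `FK.maj3_pattern_pointwise` — for the membership bits `p₁,p₂,p₃` of the three specials,
  `−(maj(p) − maj(¬p)) = (1−2·1{p₁})·1{p₂ ≠ p₃} + ½(1−2·1{p₂}) + ½(1−2·1{p₃})` (the MIX flow: `f₁ = MIX`, `f₂ = f₃ = ½·ROOT`);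
* `FK.blind_erase_union`, `FK.incr_blind`, `FK.incr_mono` — the increment `X ↦ g(X ∪ C) − g((M \ X) ∪ C)` of a monotone test function
  blind to an edge is monotone and blind to that edge;
* `FK.theta_U_pivot_nested` — Theorem U at a pivot `z` of a series–parallel network with an extra free edge `e` read by a NESTED PAIR of
  test functions `H₀ ≤ H₁` (`H₁` when `e` sits in the first replica, `H₀` when in the second): the one-sided weighted form of
  `FK.apUpcCLW_nested_nonneg_of_isTTSP` / `FK.nestedTest_mono` through `FK.theta_U_pivot` — axiom A3 of the memo in the exact shape the
  aggregation produces.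
[cite: Grimmett2006, §3.8 Thm. (3.90) (pp. 61–62); §3.9 (pp. 63–64)] [cite: Wagner2006, Thm. 5.8(d), §5.3]
-/

noncomputable section

namespace Summit.CriticalPhenomena.PercolationContinuityZ3.Theorems

namespace FK

open SimpleGraph Literature.Probability.LatticeModels Literature.Probability.Percolation
open scoped Classical

variable {V : Type*} [Fintype V]

section MixLemmas

omit [Fintype V] in
/-- Pointwise pattern identity behind the MIX criterion: for the three membership bits `p₁, p₂, p₃` of the special edges,
`−(maj(p) − maj(¬p)) = (1 − 2·1{p₁})·1{p₂ ≠ p₃} + ½(1 − 2·1{p₂}) + ½(1 − 2·1{p₃})`. [folklore] -/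
theorem maj3_pattern_pointwise (P₁ P₂ P₃ : Prop) [Decidable P₁] [Decidable P₂] [Decidable P₃] :
    -((if (P₁ ∧ P₂) ∨ (P₁ ∧ P₃) ∨ (P₂ ∧ P₃) then (1 : ℝ) else 0) -
        (if (¬P₁ ∧ ¬P₂) ∨ (¬P₁ ∧ ¬P₃) ∨ (¬P₂ ∧ ¬P₃) then (1 : ℝ) else 0)) =
      (if P₁ then (-1 : ℝ) else 1) * (if (P₂ ∧ ¬P₃) ∨ (¬P₂ ∧ P₃) then (1 : ℝ) else 0) +
        (1 / 2) * (if P₂ then (-1 : ℝ) else 1) + (1 / 2) * (if P₃ then (-1 : ℝ) else 1) := by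
  by_cases h1 : P₁ <;> by_cases h2 : P₂ <;> by_cases h3 : P₃ <;> simp [h1, h2, h3] <;> norm_num


omit [Fintype V] in
/-- A test function blind to the edge `x` does not see `x` erased either. [folklore] -/
theorem blind_erase_union {g : Finset (Sym2 V) → ℝ} {x : Sym2 V} (hg : ∀ A : Finset (Sym2 V), g (insert x A) = g A)
    (X C : Finset (Sym2 V)) : g (X.erase x ∪ C) = g (X ∪ C) := by
  by_cases hx : x ∈ X
  · conv_rhs => rw [← Finset.insert_erase hx, Finset.insert_union, hg]
  · rw [Finset.erase_eq_of_notMem hx]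

omit [Fintype V] in
/-- The increment `X ↦ g(X ∪ C) − g((M \ X) ∪ C)` of a test function blind to `x` is blind to `x`. [folklore] -/
theorem incr_blind {g : Finset (Sym2 V) → ℝ} {x : Sym2 V} (hg : ∀ A : Finset (Sym2 V), g (insert x A) = g A)
    (M C X : Finset (Sym2 V)) : g (insert x X ∪ C) - g (M \ insert x X ∪ C) = g (X ∪ C) - g (M \ X ∪ C) := by
  rw [Finset.insert_union, hg, Finset.sdiff_insert, blind_erase_union hg]

omit [Fintype V] in
/-- The increment of a monotone test function is monotone. [folklore] -/
theorem incr_mono {g : Finset (Sym2 V) → ℝ} (hmono : ∀ ⦃X Y : Finset (Sym2 V)⦄, X ⊆ Y → g X ≤ g Y)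
    (M C : Finset (Sym2 V)) ⦃X Y : Finset (Sym2 V)⦄ (hXY : X ⊆ Y) :
    g (X ∪ C) - g (M \ X ∪ C) ≤ g (Y ∪ C) - g (M \ Y ∪ C) :=
  sub_le_sub (hmono (Finset.union_subset_union hXY le_rfl))
    (hmono (Finset.union_subset_union (Finset.sdiff_subset_sdiff le_rfl hXY) le_rfl))

/-- **Theorem U at the pivot `z = uv` read by a nested pair (one-sided weighted form).**  `E` TTSP between `u, v` (the re-rooted host),
`e ∉ N` a further edge of `E` with `e ∪ N, C ⊆ E`, `z ∉ e ∪ N`; `W` antitone; `H₀ ≤ H₁` monotone on the subsets of `e ∪ N` and blind to `z`.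
Then `0 ≤ ∑_{γ ⊆ N ∪ {z}} σ_z(γ) (W(A(γ ∪ {e}) + c)·H₁(γ) + W(A(γ) + c)·H₀(γ))`, `A = apExpC (N ∪ {z,e}) C`: the flips of `z` with `e` in the
first replica, weighted by `H₁`, dominate those with `e` in the second replica weighted by `H₀` (`FK.theta_U_pivot` against the glued test
function of `FK.nestedTest_mono`). [cite: Grimmett2006, §3.8 Thm. (3.90) (pp. 61–62)] -/
theorem theta_U_pivot_nested {E : Finset (Sym2 V)} {u v : V} (hE : IsTTSP E u v) {N C : Finset (Sym2 V)} {e : Sym2 V}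
    (hN : insert e N ⊆ E) (hC : C ⊆ E) (hzN : s(u, v) ∉ insert e N) (heN : e ∉ N)
    {W : ℕ → ℝ} (hW : ∀ n, W (n + 1) ≤ W n) {H₀ H₁ : Finset (Sym2 V) → ℝ}
    (hle : ∀ ⦃A : Finset (Sym2 V)⦄, A ⊆ insert e N → H₀ A ≤ H₁ A)
    (hmono₀ : ∀ ⦃A B : Finset (Sym2 V)⦄, A ⊆ B → B ⊆ insert e N → H₀ A ≤ H₀ B)
    (hmono₁ : ∀ ⦃A B : Finset (Sym2 V)⦄, A ⊆ B → B ⊆ insert e N → H₁ A ≤ H₁ B)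
    (hH₀z : ∀ X : Finset (Sym2 V), H₀ (insert s(u, v) X) = H₀ X) (hH₁z : ∀ X : Finset (Sym2 V), H₁ (insert s(u, v) X) = H₁ X)
    (c : ℕ) :
    0 ≤ ∑ γ ∈ (insert s(u, v) N).powerset, (if s(u, v) ∈ γ then (-1 : ℝ) else 1) *
      (W (apExpC (insert e (insert s(u, v) N)) C (insert e γ) + c) * H₁ γ + W (apExpC (insert e (insert s(u, v) N)) C γ + c) * H₀ γ) := by
  have hez : e ≠ s(u, v) := fun h => hzN (h ▸ Finset.mem_insert_self _ _)
  have hzN' : s(u, v) ∉ N := fun h => hzN (Finset.mem_insert_of_mem h)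
  have heM : e ∉ insert s(u, v) N := by rw [Finset.mem_insert, not_or]; exact ⟨hez, heN⟩
  have hHz : ∀ X : Finset (Sym2 V), (fun X => if e ∈ X then H₁ (X.erase e) else H₀ X) (insert s(u, v) X) =
      (fun X => if e ∈ X then H₁ (X.erase e) else H₀ X) X := fun X => by
    have hiff : (e ∈ insert s(u, v) X) ↔ e ∈ X := by rw [Finset.mem_insert, or_iff_right hez]
    show (if e ∈ insert s(u, v) X then H₁ ((insert s(u, v) X).erase e) else H₀ (insert s(u, v) X)) =
      (if e ∈ X then H₁ (X.erase e) else H₀ X)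
    rw [Finset.erase_insert_of_ne hez.symm, hH₁z, hH₀z]
    simp only [hiff]
  have key := theta_U_pivot hE hN hC hzN hW (H := fun X => if e ∈ X then H₁ (X.erase e) else H₀ X)
    (nestedTest_mono e hle hmono₀ hmono₁) hHz c
  rw [Finset.insert_comm, Finset.sum_powerset_insert heM, ← Finset.sum_add_distrib] at key
  refine key.trans_eq (Finset.sum_congr rfl fun γ hγ => ?_)
  have hγ' := Finset.mem_powerset.1 hγ
  have heγ : e ∉ γ := fun h => heM (hγ' h)
  have hze : (s(u, v) ∈ insert e γ) = (s(u, v) ∈ γ) := by rw [Finset.mem_insert, eq_iff_iff, or_iff_right hez.symm]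
  simp only [heγ, if_false, Finset.mem_insert_self, if_true, Finset.erase_insert heγ, hze, Finset.insert_comm e s(u, v) N]
  ring

end MixLemmas

end FK

end Summit.CriticalPhenomena.PercolationContinuityZ3.Theorems

end
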